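import Summits.QuantumFields.YangMills.Theorems.UnitScaleTiltFluctuationComparisonRegPrLiftLegsFinal
import Summits.QuantumFields.YangMills.Theorems.UnitScaleTiltFluctuationComparisonRegPrAnsatzSRowBound

/-!
# Route `UnitScaleTilt` — crux `FluctuationComparisonRegPrL` (stmt-QuantumFields-19935), stub `stub_oneStepSmallLift`: the Γ-LEG LAYER, file 12 —
# THE REGISTERED SIGNATURE MODULO ONLY THE TENSOR TABLE'S ROW BOUND AT ODD `L ≥ 21` WITH THE CRUDE CONSTANTS `(18/L², 1)`
# (support file `--supports stmt-QuantumFields-19935`)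

Cell `ym3-torus` (HUMAN RULING D-0037, YM ladder rung R3), seat `ym3-torus-p1` gen 11.  ym3-torus-p2 g10's row bound for the tensor table
(`AnsatzTRows.rowT01` and its siblings) is stated with the crude constants `λ = 18/L²`, `β = 1`; `(18/L²)·√L < 1` holds exactly for `L ≥ 7`.
The odd block sizes `5 ≤ L ≤ 19` are already served by «ANSATZ S» (`AnsatzS.perL_clause`, p484152) and `L = 3` by `CertL3Tree.certL3_clause`.
Hence the registered text of `stub_oneStepSmallLift` follows from the tensor row bound at odd `L ≥ 21` alone:

* `gainT_lt_one`: `7 ≤ L → (18/L²)·√L < 1`;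
* **`stub_oneStepSmallLift_of_rowBoundT'`**: `(∀ L, Odd L → 21 ≤ L → ∀ m K hL, RowBound (P := ⟨3,L,m,K,…⟩) (Fin 2) 1 (kzT L) (18/L²) 1) →`
  `∀ L, ∃ κ δ₀, κ√L ≤ 1 ∧ 0 < δ₀ ∧ ∀ F, F.L = L → OneStepSmallLift F ℰp κ δ₀`.

Elementary bookkeeping; nothing of Bałaban's is asserted.
-/

noncomputable section

namespace Summit.QuantumFields.YangMills.Theorems.ApproxLift

open Literature.MathematicalPhysics.QuantumFieldTheory.Balaban1983to89
open Literature.MathematicalPhysics.QuantumFieldTheory.Balaban1983to89.T3ContinuumYM3Torus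
open Literature.MathematicalPhysics.QuantumFieldTheory.Balaban1983to89.T3UnitLawDensityEML (ℰp)
open Literature.MathematicalPhysics.QuantumFieldTheory.Balaban1983to89.T3SmallLiftHistory (OneStepSmallLift)

/-- **THE CRUDE TENSOR GAIN BEATS THE CRITICAL RATIO FROM `L = 7` ON**: `(18/L²)·√L < 1` (`⇔ 324 < L³`). -/
theorem gainT_lt_one {L : ℕ} (h7 : 7 ≤ L) : 18 / (L : ℝ) ^ 2 * Real.sqrt L < 1 := by
  have hL : (7 : ℝ) ≤ L := by exact_mod_cast h7
  have hL0 : (0 : ℝ) < L := by linarith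
  have hsq : Real.sqrt (L : ℝ) < (L : ℝ) ^ 2 / 18 := by
    rw [Real.sqrt_lt' (by positivity)]
    nlinarith [mul_le_mul hL hL (by norm_num) hL0.le, mul_le_mul hL (mul_le_mul hL hL (by norm_num) hL0.le) (by norm_num) hL0.le]
  calc 18 / (L : ℝ) ^ 2 * Real.sqrt L < 18 / (L : ℝ) ^ 2 * ((L : ℝ) ^ 2 / 18) := mul_lt_mul_of_pos_left hsq (by positivity)
    _ = 1 := by field_simp

/-- **THE REGISTERED SIGNATURE OF `stub_oneStepSmallLift` FROM THE TENSOR ROW BOUND AT ODD `L ≥ 21` ONLY** (crude constants `18/L²`, `1`):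
`L = 3` by `CertL3Tree.certL3_clause`, odd `5 ≤ L ≤ 19` by `AnsatzS.perL_clause`, odd `L ≥ 21` by `perL_clause_T_of_rowBound`. -/
theorem stub_oneStepSmallLift_of_rowBoundT'
    (hRB : ∀ L : ℕ, Odd L → 21 ≤ L → ∀ (m K : ℕ) (hL : Odd L ∧ 1 < L),
      RowBound (P := AnsatzS.P3 L m K hL) (Fin 2) 1 (AnsatzT.kzT L) (18 / (L : ℝ) ^ 2) 1) :
    ∀ L : ℕ, ∃ κ δ₀ : ℝ, κ * Real.sqrt L ≤ 1 ∧ 0 < δ₀ ∧ ∀ F : T3Family, F.L = L → OneStepSmallLift F ℰp κ δ₀ := by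
  refine oneStepSmallLift_stub_of_perL CertL3Tree.certL3_clause fun L hodd h5 => ?_
  by_cases h19 : L ≤ 19
  · exact AnsatzS.perL_clause hodd h5 h19
  · have h21 : 21 ≤ L := by
      obtain ⟨k, hk⟩ := hodd
      omega
    exact perL_clause_T_of_rowBound hodd h5 (by positivity) zero_le_one (gainT_lt_one (by omega)) (hRB L hodd h21)

end Summit.QuantumFields.YangMills.Theorems.ApproxLift

end
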